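import Summits.AnomalousDissipation.AnomalousDissipation.Theorems.SawtoothPulseCascadeK1LocalisedCascadeSymbolFibreDataH
import Summits.AnomalousDissipation.AnomalousDissipation.Theorems.SawtoothPulseCascadeK1LocalisedCascadeEnvelopeFibre

/-!
# K1loc, line `Spectral` / SeqCone — helper: FIRST-ORDER FIBRE DATA OF THE TRACKED PRODUCT SYMBOLS (S-B constants, H half-slot)

Helper file of the prover lane on the crux `K1LocalisedCascade` (stmt-AnomalousDissipation-19491), route
`SawtoothPulseCascade` (glue seat k1loc-p3; Stage 1b of the concrete instantiation of `…K1Ledger.cascade_ledger_step_H[′]` at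
order `r = 1`).  On the H-fibre `k_h = n` the tracked product symbols of `…SymbolPackageLattice` restrict to
`Mμ_n(t) = 1 − f(t)·g(t)` and `N_n(t) = (1 − f(t)·g(t))²` with factors `f, g : ℝ → [0,1]` of three kinds: the start-of-phase
cone factor `sT((|n| − L)/(εL))·(1 − sT((γ|t| − a|n|)/(ε_aL)))`, the complement of the mid-phase profile of
`…SymbolFibreDataH` (shifted by the branch shift), and the envelope factor of `…EnvelopeFibre`.  First-order data:
* `abs_deriv_one_sub_mul_le`, `abs_deriv_one_sub_mul_sq_le` — `|(1 − fg)′| ≤ A + B`, `|((1 − fg)²)′| ≤ 2(A + B)` from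
  `|f|, |g| ≤ 1`, `|f′| ≤ A`, `|g′| ≤ B`; values in `[0,1]`;
* `exists_bound_deriv_coneFactorH` — the cone factor: `∃ C, |f′| ≤ C/b` whenever `b·γ ≤ ε_aL` (uniform in `n`);
* `exists_bound_deriv_envFactor` — the envelope factor: `∃ C, |g′| ≤ C/b` whenever `b ≤ w`;
* `exists_bound_deriv_midFactorH` — the (shifted) mid-phase factor: `∃ C, |f′| ≤ C/b` whenever `b·γ ≤ ε_aL₀`.
So `Cμ 0 = CN 0 = 1`, `Cμ 1 = (C_S + C_E)/b`, `CN 1 = 2(C_M + C_E′)/b` in the capstone.  No definitions; no statement about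
the stub.  [cite: Grafakos2014, Prop. 3.1.2 (5)] [problem: turb]
-/

-- `Summit.<Summit>.<Problem>`: single-conjunct summit, the duplicate namespace segment is deliberate.
set_option linter.dupNamespace false

noncomputable section

namespace Summit.AnomalousDissipation.AnomalousDissipation.Theorems.SawtoothPulseCascade.K1Cutoff

open Set Filter Topology Real
open scoped ContDiff

/-! ## First-order calculus of `1 − f·g` -/

/-- `0 ≤ 1 − fg ≤ 1` for `f, g ∈ [0,1]`. [folklore] -/
theorem one_sub_mul_mem {x y : ℝ} (hx : 0 ≤ x) (hx1 : x ≤ 1) (hy : 0 ≤ y) (hy1 : y ≤ 1) :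
    0 ≤ 1 - x * y ∧ 1 - x * y ≤ 1 :=
  ⟨sub_nonneg.mpr (mul_le_one₀ hx1 hy hy1), sub_le_self _ (mul_nonneg hx hy)⟩

/-- **`|(1 − fg)′| ≤ A + B`** when `|f|, |g| ≤ 1`, `|f′| ≤ A`, `|g′| ≤ B` (pointwise, `f, g` differentiable at the point).
[folklore] -/
theorem abs_deriv_one_sub_mul_le {f g : ℝ → ℝ} {t A B : ℝ} (hf : DifferentiableAt ℝ f t) (hg : DifferentiableAt ℝ g t)
    (hf1 : |f t| ≤ 1) (hg1 : |g t| ≤ 1) (hA : |deriv f t| ≤ A) (hB : |deriv g t| ≤ B) :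
    |deriv (fun t => 1 - f t * g t) t| ≤ A + B := by
  have hA0 : 0 ≤ A := (abs_nonneg _).trans hA
  have hB0 : 0 ≤ B := (abs_nonneg _).trans hB
  have hmul : HasDerivAt (fun t => f t * g t) (deriv f t * g t + f t * deriv g t) t := hf.hasDerivAt.mul hg.hasDerivAt
  have h : deriv (fun t => 1 - f t * g t) t = -(deriv f t * g t + f t * deriv g t) := (hmul.const_sub 1).deriv
  rw [h, abs_neg]
  calc |deriv f t * g t + f t * deriv g t| ≤ |deriv f t| * |g t| + |f t| * |deriv g t| := by
        rw [← abs_mul, ← abs_mul]; exact abs_add_le _ _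
    _ ≤ A * 1 + 1 * B := add_le_add (mul_le_mul hA hg1 (abs_nonneg _) hA0) (mul_le_mul hf1 hB (abs_nonneg _) zero_le_one)
    _ = A + B := by ring

/-- **`|((1 − fg)²)′| ≤ 2(A + B)`** under the same hypotheses with `0 ≤ f, g ≤ 1`. [folklore] -/
theorem abs_deriv_one_sub_mul_sq_le {f g : ℝ → ℝ} {t A B : ℝ} (hf : DifferentiableAt ℝ f t) (hg : DifferentiableAt ℝ g t)
    (hf0 : 0 ≤ f t) (hf1 : f t ≤ 1) (hg0 : 0 ≤ g t) (hg1 : g t ≤ 1) (hA : |deriv f t| ≤ A) (hB : |deriv g t| ≤ B) :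
    |deriv (fun t => (1 - f t * g t) ^ 2) t| ≤ 2 * (A + B) := by
  have hd : DifferentiableAt ℝ (fun t => 1 - f t * g t) t := (hf.mul hg).const_sub 1
  have hpow : HasDerivAt (fun t => (1 - f t * g t) ^ 2) (((2 : ℕ) : ℝ) * (1 - f t * g t) ^ (2 - 1) *
      deriv (fun t => 1 - f t * g t) t) t := hd.hasDerivAt.pow 2
  have h : deriv (fun t => (1 - f t * g t) ^ 2) t = 2 * (1 - f t * g t) * deriv (fun t => 1 - f t * g t) t := by
    rw [hpow.deriv]; norm_num
  rw [h, abs_mul, abs_mul, abs_two]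
  obtain ⟨h0, h1⟩ := one_sub_mul_mem hf0 hf1 hg0 hg1
  have hval : |1 - f t * g t| ≤ 1 := by rw [abs_of_nonneg h0]; exact h1
  have hder := abs_deriv_one_sub_mul_le hf hg (by rw [abs_of_nonneg hf0]; exact hf1) (by rw [abs_of_nonneg hg0]; exact hg1) hA hB
  calc 2 * |1 - f t * g t| * |deriv (fun t => 1 - f t * g t) t| ≤ 2 * 1 * (A + B) :=
        mul_le_mul (mul_le_mul_of_nonneg_left hval zero_le_two) hder (abs_nonneg _) (by positivity)
    _ = 2 * (A + B) := by ring

/-! ## The three factors along an H-fibre: first-derivative bounds at scale `b` -/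

/-- **The start-of-phase cone factor** `f(t) = sT((|n| − L)/(εL))·(1 − sT((γ|t| − a|n|)/(ε_aL)))` (`γ, a, ε, ε_a, L > 0`):
differentiable, with values in `[0,1]`, and `∃ C ≥ 0` (absolute) with `|f′(t)| ≤ C/b` whenever `0 < b`, `b·γ ≤ ε_aL`, for every
fibre `n ∈ ℤ`. [cite: Grafakos2014, Prop. 3.1.2 (5)] -/
theorem exists_bound_deriv_coneFactorH :
    ∃ C : ℝ, 0 ≤ C ∧ ∀ {γ ε εa a L b : ℝ}, 0 < γ → 0 < ε → 0 < εa → 0 < a → 0 < L → 0 < b → b * γ ≤ εa * L →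
      ∀ (n : ℤ) (t : ℝ),
        DifferentiableAt ℝ (fun t : ℝ => smoothTransition ((|(n : ℝ)| - L) / (ε * L)) *
          (1 - smoothTransition ((γ * |t| - a * |(n : ℝ)|) / (εa * L)))) t ∧
        |deriv (fun t : ℝ => smoothTransition ((|(n : ℝ)| - L) / (ε * L)) *
          (1 - smoothTransition ((γ * |t| - a * |(n : ℝ)|) / (εa * L)))) t| ≤ C / b := by
  obtain ⟨C, hC0, hC⟩ := exists_bound_iteratedDeriv_envFactor 1
  refine ⟨C, hC0, ?_⟩
  intro γ ε εa a L b hγ hε hεa ha hL hb hbγ n t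
  rcases eq_or_ne n 0 with hn | hn
  · -- `n = 0`: the radial factor vanishes, `f ≡ 0`
    have h0 : smoothTransition ((|((0 : ℤ) : ℝ)| - L) / (ε * L)) = 0 :=
      Real.smoothTransition.zero_of_nonpos (div_nonpos_of_nonpos_of_nonneg (by simp; exact hL.le) (by positivity))
    subst hn
    simp only [h0, zero_mul]
    exact ⟨differentiableAt_const _, by rw [deriv_const]; simp; positivity⟩
  · -- `n ≠ 0`: rewrite as the envelope-factor shape with `R = a|n|/γ`, `w = ε_aL/γ`, `t₀ = 0`
    have hR : 0 < a * |(n : ℝ)| / γ := by have : 0 < |(n : ℝ)| := abs_pos.mpr (by exact_mod_cast hn); positivity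
    have hw : 0 < εa * L / γ := by positivity
    have hfun : (fun t : ℝ => smoothTransition ((|(n : ℝ)| - L) / (ε * L)) *
        (1 - smoothTransition ((γ * |t| - a * |(n : ℝ)|) / (εa * L)))) =
        fun t : ℝ => smoothTransition ((|(n : ℝ)| - L) / (ε * L)) *
          (1 - smoothTransition ((|t - 0| - a * |(n : ℝ)| / γ) / (εa * L / γ))) := by
      funext t; rw [sub_zero]; congr 3; field_simp
    rw [hfun]
    have hc0 := Real.smoothTransition.nonneg ((|(n : ℝ)| - L) / (ε * L))
    have hc1 := Real.smoothTransition.le_one ((|(n : ℝ)| - L) / (ε * L))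
    refine ⟨((contDiff_envFactor hR hw _ 0 (m := 1)).differentiable (by simp) t), ?_⟩
    have h := hC hc0 hc1 hR hw hb (by rw [le_div_iff₀ hγ]; exact hbγ) 0 t
    rwa [iteratedDeriv_one, pow_one] at h

/-- **The envelope factor** `g(t) = (1 − sT((|n| − R)/w))·(1 − sT((|t − t₀| − R)/w))` (`R, w > 0`): differentiable, and
`∃ C ≥ 0` (absolute) with `|g′(t)| ≤ C/b` whenever `0 < b ≤ w`. [cite: Grafakos2014, Prop. 3.1.2 (5)] -/
theorem exists_bound_deriv_envFactor :
    ∃ C : ℝ, 0 ≤ C ∧ ∀ {R w b : ℝ}, 0 < R → 0 < w → 0 < b → b ≤ w → ∀ (n : ℤ) (t₀ t : ℝ),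
      DifferentiableAt ℝ (fun t : ℝ => (1 - smoothTransition ((|(n : ℝ)| - R) / w)) *
        (1 - smoothTransition ((|t - t₀| - R) / w))) t ∧
      |deriv (fun t : ℝ => (1 - smoothTransition ((|(n : ℝ)| - R) / w)) * (1 - smoothTransition ((|t - t₀| - R) / w))) t| ≤
        C / b := by
  obtain ⟨C, hC0, hC⟩ := exists_bound_iteratedDeriv_envFactor 1
  refine ⟨C, hC0, ?_⟩
  intro R w b hR hw hb hbw n t₀ t
  have hc0 : 0 ≤ 1 - smoothTransition ((|(n : ℝ)| - R) / w) := sub_nonneg.mpr (Real.smoothTransition.le_one _)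
  have hc1 : 1 - smoothTransition ((|(n : ℝ)| - R) / w) ≤ 1 := sub_le_self _ (Real.smoothTransition.nonneg _)
  refine ⟨(contDiff_envFactor hR hw _ t₀ (m := 1)).differentiable (by simp) t, ?_⟩
  have h := hC hc0 hc1 hR hw hb hbw t₀ t
  rwa [iteratedDeriv_one, pow_one] at h

/-- **The mid-phase factor, shifted** `f(t) = 1 − P(t)` with `P` the H-fibre profile of `1 − g^M(n, · − t₀)` of
`…SymbolFibreDataH` (`ε, ε_a, a₂, L₀ > 0`, `γ ≥ 0`): differentiable, and `∃ C ≥ 0` (absolute) with `|f′(t)| ≤ C/b` whenever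
`0 < b`, `b·γ ≤ ε_aL₀`. [cite: Grafakos2014, Prop. 3.1.2 (5)] -/
theorem exists_bound_deriv_midFactorH :
    ∃ C : ℝ, 0 ≤ C ∧ ∀ {γ ε εa a₂ L₀ b : ℝ}, 0 ≤ γ → 0 < ε → 0 < εa → 0 < a₂ → 0 < L₀ → 0 < b → b * γ ≤ εa * L₀ →
      ∀ (n : ℤ) (t₀ t : ℝ),
      DifferentiableAt ℝ (fun t : ℝ => 1 - (1 - smoothTransition ((|(n : ℝ)| - L₀) / (ε * L₀)) *
        (1 - smoothTransition ((γ * |t - t₀ + γ * n| - a₂ * |(n : ℝ)|) / (εa * L₀)) *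
          smoothTransition ((γ * |t - t₀ - γ * n| - a₂ * |(n : ℝ)|) / (εa * L₀))))) t ∧
      |deriv (fun t : ℝ => 1 - (1 - smoothTransition ((|(n : ℝ)| - L₀) / (ε * L₀)) *
        (1 - smoothTransition ((γ * |t - t₀ + γ * n| - a₂ * |(n : ℝ)|) / (εa * L₀)) *
          smoothTransition ((γ * |t - t₀ - γ * n| - a₂ * |(n : ℝ)|) / (εa * L₀))))) t| ≤ C / b := by
  obtain ⟨C, hC0, hC⟩ := exists_bound_iteratedDeriv_symM_fibreH 1
  refine ⟨C, hC0, ?_⟩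
  intro γ ε εa a₂ L₀ b hγ hε hεa ha₂ hL₀ hb hbγ n t₀ t
  have hP : ContDiff ℝ 1 (fun t : ℝ => 1 - smoothTransition ((|(n : ℝ)| - L₀) / (ε * L₀)) *
      (1 - smoothTransition ((γ * |t - t₀ + γ * n| - a₂ * |(n : ℝ)|) / (εa * L₀)) *
        smoothTransition ((γ * |t - t₀ - γ * n| - a₂ * |(n : ℝ)|) / (εa * L₀)))) :=
    contDiff_symM_fibreH (γ := γ) hε hεa hL₀ ha₂ (n : ℝ) t₀
  have hPd : DifferentiableAt ℝ (fun t : ℝ => 1 - smoothTransition ((|(n : ℝ)| - L₀) / (ε * L₀)) *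
      (1 - smoothTransition ((γ * |t - t₀ + γ * n| - a₂ * |(n : ℝ)|) / (εa * L₀)) *
        smoothTransition ((γ * |t - t₀ - γ * n| - a₂ * |(n : ℝ)|) / (εa * L₀)))) t := hP.differentiable (by simp) t
  refine ⟨hPd.const_sub 1, ?_⟩
  rw [deriv_const_sub, abs_neg]
  have h := hC hγ hε hεa ha₂ hL₀ hb hbγ (n : ℝ) t₀ t
  rwa [iteratedDeriv_one, pow_one] at h

end Summit.AnomalousDissipation.AnomalousDissipation.Theorems.SawtoothPulseCascade.K1Cutoff
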